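import Summits.ResolutionOfSingularities.ResolutionOfSingularities.Theorems.EquisingularLiftEquisingularLiftNatResolveOnePoint
import Summits.ResolutionOfSingularities.ResolutionOfSingularities.Theorems.EquisingularLiftEquisingularLiftNatHorizChainE1Sections
import Summits.ResolutionOfSingularities.ResolutionOfSingularities.Theorems.EquisingularLiftEquisingularLiftNatPointStepTransport
import HarnessLib

/-!
# [OURS · L1 W4.5(b) · EL♮ T-ISO-0] THE SECTION STEP IN ANY DIMENSION, mirrored on a downstairs point blow-up
# (brick 2 of res-L1-w45b-lead-2's target T-ISO-0 «point-only downstairs embedded resolutions lift to horizontal E1 section chains»,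
# `L/res-L1-w45b-lead-2/TARGET-T-ISO-0.lean` d0ee84fae5c3adea)

Crux `EquisingularLiftNat` = stmt-ResolutionOfSingularities-20038, line `sections`; helper file `--supports … --as helper` by
res-D-pv-029 (T-ISO-0 first call, res-plan-2 D→L MAP v1.14a). HONEST FRAMING: OURS (cell res-hironaka, slot W4.5(b)); NOT a statement
of any manuscript. AI-written, weaker than expert review. No `sorry`; standard axioms.

THE STEP (`pointStep`). Fixed: a complete DVR `O` with algebraically closed residue field, the ambient `q : P → Spec O` (smooth, proper),
`Y ⊆ P` closed irreducible inside the special fibre, a stage predicate `Ch` over `P` closed under HORIZONTAL E1 steps (regular centre,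
`O`-FLAT, off the generic point of `Y`, special points inside the current strict transform — exactly T-ISO-0's conclusion clause) and
implying `Split.Chain`. UPSTAIRS stage `(X', σ', S')` with `Ch`, irreducible special fibre and good reduction at EVERY special-fibre
point. DOWNSTAIRS: any locally Noetherian `F₁`, a closed irreducible `T₁ ⊆ F₁`, a NON-REGULAR point `x` of `V(closure T₁)_red` whose image
is a CLOSED point of `F₁`, a blow-up `υ : F₂ → F₁` at that reduced point, and an ISOMORPHISM `e : V(closure T₁)_red ≅ V(closure S')_red`.
OUTPUT: the next upstairs stage `(X'', τ ≫ σ', S'' = closure τ⁻¹(S' ∖ s(Spec O)))` — the blow-up of `X'` along a Hensel SECTION `s` through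
the point `e x` — with `Ch`, irreducible special fibre, good reduction at every special-fibre point, together with
`IsLocallyNoetherian F₂`, irreducibility of the downstairs strict transform `closure υ⁻¹(T₁ ∖ {x})`, and an isomorphism
`V(closure (closure υ⁻¹(T₁ ∖ {x})))_red ≅ V(closure S'')_red` (brick 1 `nonempty_iso_reducedStrictTransform_step`).

The upstairs half is steps (s1)–(s10) of `resolveOnePointNat_dimOne_dim` (res-L1-w45b-stub / p498502 lineage) with every curve
hypothesis removed: closedness of the blown-up point is INPUT (from the downstairs chain through `e`), not derived from `dim ≤ 1`.

References: Theorems/EquisingularLiftEquisingularLiftNatResolveOnePoint.lean (the engine), …NatHorizChainE1Sections.lean (flat section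
centres), …NatPointStepTransport.lean (brick 1); Liu 2002 §8.1; L/w45b/CRUX-PLAN.md v3.
-/

set_option linter.dupNamespace false -- mandated namespace `Summit.<Summit>.<Problem>` of this single-conjunct summit
set_option linter.overlappingInstances false -- signatures carry `[IsDomain O] [IsDiscreteValuationRing O]`

noncomputable section

open CategoryTheory CategoryTheory.Limits AlgebraicGeometry TopologicalSpace Topology
open Literature.AlgebraicGeometry.Resolution
open AlgebraicGeometry.Scheme.IdealSheafData
open Summit.ResolutionOfSingularities.ResolutionOfSingularities.Theses.EquisingularLift.Split
open Summit.ResolutionOfSingularities.ResolutionOfSingularities.Cruxes.EquisingularLift.StrataSplit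

namespace Summit.ResolutionOfSingularities.ResolutionOfSingularities.Cruxes.EquisingularLiftNat.Sections

universe u

/-! ## Small transport lemmas along an isomorphism of schemes -/

/-- Regularity of local rings is invariant under isomorphisms of schemes (pointwise). [folklore] -/
theorem isRegularLocalRing_stalk_iff_of_iso {X Y : Scheme.{u}} (e : X ≅ Y) (x : X) :
    IsRegularLocalRing (Y.presheaf.stalk (e.hom x)) ↔ IsRegularLocalRing (X.presheaf.stalk x) := by
  haveI : IsIso (e.hom.stalkMap x) := ((isIso_iff_isIso_stalkMap e.hom).mp inferInstance).2 x
  let f : Y.presheaf.stalk (e.hom x) ≃+* X.presheaf.stalk x := (asIso (e.hom.stalkMap x)).commRingCatIsoToRingEquiv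
  exact ⟨fun h => IsRegularLocalRing.of_ringEquiv f, fun h => IsRegularLocalRing.of_ringEquiv f.symm⟩

/-- The image of a closed point under an isomorphism of schemes is a closed point. [folklore] -/
theorem isClosed_singleton_hom_of_iso {X Y : Scheme.{u}} (e : X ≅ Y) {x : X} (hx : IsClosed ({x} : Set X)) :
    IsClosed ({e.hom x} : Set Y) := by
  have h := e.hom.isClosedEmbedding.isClosedMap _ hx
  rwa [Set.image_singleton] at h

/-! ## The step -/

/-- **THE SECTION STEP OF T-ISO-0, any dimension** (see the module docstring for the reading). [folklore; Liu 2002 §8.1] -/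
theorem pointStep (O : Type) [CommRing O] [IsDomain O] [IsDiscreteValuationRing O]
    [IsAdicComplete (IsLocalRing.maximalIdeal O) O] [IsAlgClosed (IsLocalRing.ResidueField O)]
    (P : Scheme.{0}) (q : P ⟶ Spec (.of O)) (Y : Closeds P)
    (Ch : ∀ X' : Scheme.{0}, (X' ⟶ P) → Set X' → Prop)
    (hChain : ∀ (X' : Scheme.{0}) (σ : X' ⟶ P) (S : Set X'), Ch X' σ S → Chain P (Y : Set P) X' σ S)
    (hStep : ∀ (X' X'' : Scheme.{0}) (σ' : X' ⟶ P) (S' : Set X') (C : X'.IdealSheafData) (τ : X'' ⟶ X'),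
      Ch X' σ' S' → IsBlowup τ C → Scheme.IsRegular C.subscheme → Flat (C.subschemeι ≫ σ' ≫ q) →
      σ' '' (C.support : Set X') ⊆ {x : P | ¬ IsGenericPoint x (Y : Set P)} →
      (C.support : Set X') ∩ (σ' ≫ q) ⁻¹' {IsLocalRing.closedPoint O} ⊆ S' →
      Ch X'' (τ ≫ σ') (closure (τ ⁻¹' (S' \ (C.support : Set X')))))
    (hq : Smooth q) (hqp : IsProper q)
    (hY : (Y : Set P) ⊆ q ⁻¹' {IsLocalRing.closedPoint O}) (hYirr : IsIrreducible (Y : Set P))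
    -- the upstairs stage
    (X' : Scheme.{0}) (σ' : X' ⟶ P) (S' : Set X') (hCh : Ch X' σ' S')
    (hirr : IsIrreducible ((σ' ≫ q) ⁻¹' {IsLocalRing.closedPoint O}))
    (hgood : ∀ w : X', (σ' ≫ q) w = IsLocalRing.closedPoint O → GoodAt (σ' ≫ q) w)
    -- the downstairs stage and step
    (F₁ F₂ : Scheme.{0}) [IsLocallyNoetherian F₁] (T₁ : Set F₁) (hT₁cl : IsClosed T₁) (hT₁irr : IsIrreducible T₁)
    (x : ↥(vanishingIdeal (⟨closure T₁, isClosed_closure⟩ : Closeds F₁)).subscheme)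
    (hx : IsClosed ({((vanishingIdeal (⟨closure T₁, isClosed_closure⟩ : Closeds F₁)).subschemeι x : F₁)} : Set F₁))
    (hxreg : ¬ IsRegularLocalRing ((vanishingIdeal (⟨closure T₁, isClosed_closure⟩ : Closeds F₁)).subscheme.presheaf.stalk x))
    (υ : F₂ ⟶ F₁)
    (hυ : IsBlowup υ (vanishingIdeal ⟨{((vanishingIdeal (⟨closure T₁, isClosed_closure⟩ : Closeds F₁)).subschemeι x : F₁)}, hx⟩))
    -- the identification of the reduced strict transforms
    (e : (vanishingIdeal (⟨closure T₁, isClosed_closure⟩ : Closeds F₁)).subscheme ≅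
      (vanishingIdeal (⟨closure S', isClosed_closure⟩ : Closeds X')).subscheme) :
    ∃ (X'' : Scheme.{0}) (σ'' : X'' ⟶ P) (S'' : Set X''),
      Ch X'' σ'' S'' ∧ IsIrreducible ((σ'' ≫ q) ⁻¹' {IsLocalRing.closedPoint O}) ∧
      (∀ w : X'', (σ'' ≫ q) w = IsLocalRing.closedPoint O → GoodAt (σ'' ≫ q) w) ∧
      IsLocallyNoetherian F₂ ∧
      IsIrreducible (closure (υ ⁻¹' (T₁ \ {((vanishingIdeal (⟨closure T₁, isClosed_closure⟩ : Closeds F₁)).subschemeι x : F₁)}))) ∧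
      Nonempty ((vanishingIdeal (⟨closure (closure (υ ⁻¹' (T₁ \
          {((vanishingIdeal (⟨closure T₁, isClosed_closure⟩ : Closeds F₁)).subschemeι x : F₁)}))), isClosed_closure⟩ :
          Closeds F₂)).subscheme ≅ (vanishingIdeal (⟨closure S'', isClosed_closure⟩ : Closeds X'')).subscheme) := by
  classical
  have hch : Chain P (Y : Set P) X' σ' S' := hChain _ _ _ hCh
  -- ambient facts
  haveI := hq
  haveI := hqp
  have hPnoeth : IsLocallyNoetherian P := LocallyOfFiniteType.isLocallyNoetherian q
  have hPreg : Scheme.IsRegular P := fun y => (stub_goodAtOfSmooth O P q hq y).1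
  obtain ⟨hnoeth', hreg', hσ'⟩ := chain_isRegular P (Y : Set P) X' σ' S' hch hPnoeth hPreg
  haveI := hnoeth'
  haveI := hσ'
  set r' : X' ⟶ Spec (.of O) := σ' ≫ q with hr'
  haveI : IsProper r' := inferInstance
  set s₀ := IsLocalRing.closedPoint O with hs₀def
  -- `S'` is closed irreducible inside the special fibre
  obtain ⟨ξ, hξ⟩ : ∃ ξ : P, IsGenericPoint ξ (Y : Set P) := QuasiSober.sober hYirr Y.isClosed
  obtain ⟨ξ', hfib', hS'⟩ := Chain.fibre hch hξ
  have hS'cl : IsClosed S' := by rw [hS']; exact isClosed_closure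
  have hclS' : closure S' = S' := hS'cl.closure_eq
  have hS'irr : IsIrreducible (closure S') := by
    rw [hS', closure_closure]; exact isIrreducible_singleton.closure
  have hS'sub : closure S' ⊆ r' ⁻¹' {s₀} := closure_subset_preimage_of_chain q hYirr Y.isClosed hY hch
  have hgen' : IsGenericPoint ξ' (closure S') := by rw [isGenericPoint_def, hS', closure_closure]
  -- the point to blow up: `z₁ = e x`, `w₁ = ι' z₁`
  set z₁ : ↥(vanishingIdeal (⟨closure S', isClosed_closure⟩ : Closeds X')).subscheme := e.hom x with hz₁def
  set w₁ : X' := (vanishingIdeal (⟨closure S', isClosed_closure⟩ : Closeds X')).subschemeι z₁ with hw₁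
  have hz₁reg : ¬ IsRegularLocalRing
      ((vanishingIdeal (⟨closure S', isClosed_closure⟩ : Closeds X')).subscheme.presheaf.stalk z₁) := fun h =>
    hxreg ((isRegularLocalRing_stalk_iff_of_iso e x).mp h)
  have hrange' : Set.range (vanishingIdeal (⟨closure S', isClosed_closure⟩ : Closeds X')).subschemeι = closure S' := by
    rw [range_subschemeι, coe_support_vanishingIdeal]; rfl
  have hw₁mem : w₁ ∈ closure S' := (Set.ext_iff.mp hrange' _).mp (Set.mem_range_self z₁)
  have hr'w₁ : r' w₁ = s₀ := hS'sub hw₁mem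
  have hw₁gen : ¬ IsGenericPoint w₁ (closure S') :=
    not_isGenericPoint_of_not_isRegularLocalRing (⟨closure S', isClosed_closure⟩ : Closeds X') hS'irr z₁ hz₁reg
  -- `w₁` is a closed point of `X'`: `{x}` is closed in `V(closure T₁)`, transport through `e` and the closed immersion `ι'`
  have hxcl : IsClosed ({x} : Set ↥(vanishingIdeal (⟨closure T₁, isClosed_closure⟩ : Closeds F₁)).subscheme) := by
    have heq : ({x} : Set _) = (vanishingIdeal (⟨closure T₁, isClosed_closure⟩ : Closeds F₁)).subschemeι ⁻¹'
        {((vanishingIdeal (⟨closure T₁, isClosed_closure⟩ : Closeds F₁)).subschemeι x : F₁)} := by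
      ext z
      simp only [Set.mem_singleton_iff, Set.mem_preimage]
      exact ⟨fun h => by rw [h],
        fun h => (vanishingIdeal (⟨closure T₁, isClosed_closure⟩ : Closeds F₁)).subschemeι.isClosedEmbedding.injective h⟩
    rw [heq]
    exact hx.preimage (Scheme.Hom.continuous _)
  have hz₁cl : IsClosed ({z₁} : Set ↥(vanishingIdeal (⟨closure S', isClosed_closure⟩ : Closeds X')).subscheme) :=
    isClosed_singleton_hom_of_iso e hxcl
  have hw₁cl : IsClosed ({w₁} : Set X') := by
    have h := (vanishingIdeal (⟨closure S', isClosed_closure⟩ : Closeds X')).subschemeι.isClosedEmbedding.isClosedMap _ hz₁cl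
    rwa [Set.image_singleton] at h
  -- (s1) the stage is integral and flat over `O`
  have hga : GoodAt r' w₁ := hgood w₁ hr'w₁
  obtain ⟨hint', hflat', -⟩ := isIntegral_and_flat_of_goodAt O X' r' hnoeth' hreg' hirr ⟨w₁, hr'w₁, hga⟩
  haveI := hint'
  -- (s2) a smooth neighbourhood of `w₁`
  haveI : LocallyOfFinitePresentation r' := locallyOfFinitePresentation_of_isLocallyNoetherian' r'
  obtain ⟨U, hw₁U, hU⟩ := exists_smooth_nhd_of_goodAt O X' r' inferInstance hflat' w₁ hr'w₁ hga
  -- (s4) a `κ`-point at `w₁` and a section through it (Hensel)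
  obtain ⟨xpt, hxr, hxrange⟩ := exists_point_of_isClosed O X' r' inferInstance w₁ hw₁cl hr'w₁
  obtain ⟨s, hs, hsx⟩ := exists_section_of_smooth O X' r' U hU xpt
    (by rw [hxrange]; exact Set.singleton_subset_iff.mpr hw₁U) hxr
  have hss₀ : s s₀ = w₁ := by
    haveI : IsLocalHom (CommRingCat.ofHom (IsLocalRing.residue O)).hom :=
      inferInstanceAs (IsLocalHom (IsLocalRing.residue O))
    have h1 : Spec.map (CommRingCat.ofHom (IsLocalRing.residue O))
        (IsLocalRing.closedPoint (IsLocalRing.ResidueField O)) = s₀ := AlgebraicGeometry.Spec_closedPoint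
    have h2 : s s₀ = xpt (IsLocalRing.closedPoint (IsLocalRing.ResidueField O)) := by
      rw [← h1, ← Scheme.Hom.comp_apply, hsx]
    rw [h2]
    exact (Set.ext_iff.mp hxrange _).mp (Set.mem_range_self _)
  have hsU : s s₀ ∈ U := hss₀ ▸ hw₁U
  have hrs : ∀ t : Spec (.of O), r' (s t) = t := fun t => by
    rw [← Scheme.Hom.comp_apply, hs]; rfl
  -- (s5) the centre `C = s.ker`
  obtain ⟨_, hCreg, -, hCsupp⟩ := section_isClosedImmersion_and_isRegular_ker O X' r' s hs
  have hCspecial : ∀ c ∈ (s.ker.support : Set X'), r' c = s₀ → c = w₁ := by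
    intro c hc hcs
    rw [hCsupp] at hc
    obtain ⟨t, rfl⟩ := hc
    rw [hrs] at hcs
    rw [hcs, hss₀]
  have hξ'mem : ξ' ∈ closure S' := by rw [hS', closure_closure]; exact subset_closure rfl
  have hξ'C : ξ' ∉ (s.ker.support : Set X') := fun h => hw₁gen (hCspecial ξ' h (hS'sub hξ'mem) ▸ hgen')
  have hCne : s.ker ≠ ⊥ := by
    intro h
    apply hξ'C
    rw [h, Scheme.IdealSheafData.support_bot]
    trivial
  have hnotsub : ¬ closure S' ⊆ (s.ker.support : Set X') := fun h => hξ'C (h hξ'mem)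
  -- (s6) blow up
  obtain ⟨X'', τ, hτ⟩ := exists_isBlowup X' s.ker
  haveI : IsProper τ := hτ.isProper
  have hnoeth'' : IsLocallyNoetherian X'' := LocallyOfFiniteType.isLocallyNoetherian τ
  haveI := hnoeth''
  -- (s7) the extended horizontal E1 chain
  have hTY : σ' '' (s.ker.support : Set X') ⊆ {y : P | ¬ IsGenericPoint y (Y : Set P)} := by
    rintro _ ⟨c, hc, rfl⟩ hgen
    have hcs : r' c = s₀ := by
      show (σ' ≫ q) c = s₀
      rw [Scheme.Hom.comp_apply]
      exact hY hgen.mem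
    have hc' := hCspecial c hc hcs
    have h1 : σ' c = ξ := hgen.eq hξ
    have h2 : c = ξ' := by
      have : c ∈ σ' ⁻¹' {ξ} := h1
      rw [hfib'] at this
      simpa using this
    exact hw₁gen (h2.symm.trans hc' ▸ hgen')
  have hE1 : (s.ker.support : Set X') ∩ (σ' ≫ q) ⁻¹' {s₀} ⊆ S' := by
    rintro c ⟨hc, hcs⟩
    rw [hCspecial c hc hcs, ← hclS']
    exact hw₁mem
  haveI : IsSeparated r' := inferInstance
  have hflatC : Flat (s.ker.subschemeι ≫ σ' ≫ q) := flat_kerSubschemeι_comp_of_section O r' s hs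
  have hCh'' : Ch X'' (τ ≫ σ') (closure (τ ⁻¹' (S' \ (s.ker.support : Set X')))) :=
    hStep X' X'' σ' S' s.ker τ hCh hτ hCreg hflatC hTY hE1
  -- (s8) the special fibre stays irreducible
  have hirr'' : IsIrreducible (((τ ≫ σ') ≫ q) ⁻¹' {s₀}) := by
    rw [Category.assoc]
    exact isIrreducible_specialFibre_of_isBlowup_section O X' X'' r' U hU s hs hsU hCne τ hτ hirr
  -- (s10) good reduction at every special-fibre point of `X''`
  let Wc : X'.Opens := ⟨(s.ker.support : Set X')ᶜ, s.ker.support.isClosed.isOpen_compl⟩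
  have hWc : IsIso (τ ∣_ Wc) := hτ.isIso_morphismRestrict disjoint_compl_left
  have hgood'' : ∀ w : X'', ((τ ≫ σ') ≫ q) w = s₀ → GoodAt ((τ ≫ σ') ≫ q) w := by
    intro w hw
    rw [Category.assoc] at hw ⊢
    have hτw : r' (τ w) = s₀ := by
      rw [hr']
      rwa [Scheme.Hom.comp_apply] at hw
    by_cases hC : τ w ∈ (s.ker.support : Set X')
    · have hc' : τ w = s s₀ := (hCspecial _ hC hτw).trans hss₀.symm
      exact goodAt_of_isBlowup_section O X' X'' r' U hU s hs hsU τ hτ w hc'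
    · exact (stub_goodAtOverIso X' X'' τ Wc hWc w (τ w) rfl hC O r').mpr (hgood (τ w) hτw)
  -- DOWNSTAIRS bookkeeping: `F₂` is locally Noetherian; the centre is a proper subset of `closure T₁`
  haveI : IsProper υ := hυ.isProper
  have hnoethF₂ : IsLocallyNoetherian F₂ := LocallyOfFiniteType.isLocallyNoetherian υ
  haveI := hnoethF₂
  have hclT₁ : closure T₁ = T₁ := hT₁cl.closure_eq
  have hT₁irr' : IsIrreducible (closure T₁) := by rw [hclT₁]; exact hT₁irr
  have hne : ¬ closure T₁ ⊆ {((vanishingIdeal (⟨closure T₁, isClosed_closure⟩ : Closeds F₁)).subschemeι x : F₁)} := by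
    intro hsub
    -- the generic point of `closure T₁` would be the image of the non-regular point `x`
    obtain ⟨η, hη⟩ : ∃ η : F₁, IsGenericPoint η (closure T₁) := QuasiSober.sober hT₁irr' isClosed_closure
    have hηx : η = ((vanishingIdeal (⟨closure T₁, isClosed_closure⟩ : Closeds F₁)).subschemeι x : F₁) := hsub hη.mem
    exact not_isGenericPoint_of_not_isRegularLocalRing (⟨closure T₁, isClosed_closure⟩ : Closeds F₁) hT₁irr' x hxreg
      (hηx ▸ hη)
  -- the TRANSPORT (brick 1): the new reduced strict transforms are isomorphic
  have hex : ((vanishingIdeal (⟨closure S', isClosed_closure⟩ : Closeds X')).subschemeι (e.hom x) : X') = s s₀ := hss₀.symm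
  obtain ⟨e₂⟩ := nonempty_iso_reducedStrictTransform_step O F₁ F₂ (closure T₁) isClosed_closure hT₁irr' x hx hne υ hυ
    X' X'' r' s hs τ hτ (closure S') isClosed_closure hS'irr hS'sub hnotsub e hex
  -- rewrite the two strict-transform sets into the forms of the conclusion
  have hsuppx : ((vanishingIdeal (⟨{((vanishingIdeal (⟨closure T₁, isClosed_closure⟩ : Closeds F₁)).subschemeι x : F₁)}, hx⟩ :
      Closeds F₁)).support : Set F₁) = {((vanishingIdeal (⟨closure T₁, isClosed_closure⟩ : Closeds F₁)).subschemeι x : F₁)} := by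
    rw [coe_support_vanishingIdeal]; rfl
  have hD : (⟨closure (υ ⁻¹' (closure T₁ \ ((vanishingIdeal (⟨{((vanishingIdeal (⟨closure T₁, isClosed_closure⟩ :
        Closeds F₁)).subschemeι x : F₁)}, hx⟩ : Closeds F₁)).support : Set F₁))), isClosed_closure⟩ : Closeds F₂) =
      ⟨closure (closure (υ ⁻¹' (T₁ \ {((vanishingIdeal (⟨closure T₁, isClosed_closure⟩ : Closeds F₁)).subschemeι x : F₁)}))),
        isClosed_closure⟩ := by
    have hdiff : closure T₁ \ {((vanishingIdeal (⟨closure T₁, isClosed_closure⟩ : Closeds F₁)).subschemeι x : F₁)} =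
        T₁ \ {((vanishingIdeal (⟨closure T₁, isClosed_closure⟩ : Closeds F₁)).subschemeι x : F₁)} :=
      Set.ext fun y => ⟨fun h => ⟨hT₁cl.closure_eq.subset h.1, h.2⟩, fun h => ⟨subset_closure h.1, h.2⟩⟩
    apply Closeds.ext
    change closure _ = closure (closure _)
    rw [closure_closure, hsuppx, hdiff]
  have hUp : (⟨closure (τ ⁻¹' (closure S' \ (s.ker.support : Set X'))), isClosed_closure⟩ : Closeds X'') =
      ⟨closure (closure (τ ⁻¹' (S' \ (s.ker.support : Set X')))), isClosed_closure⟩ := by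
    apply Closeds.ext
    change closure _ = closure (closure _)
    rw [closure_closure, hclS']
  rw [hD, hUp] at e₂
  -- irreducibility of the downstairs strict transform, through `e₂` and the upstairs generic point
  have hch'' : Chain P (Y : Set P) X'' (τ ≫ σ') (closure (τ ⁻¹' (S' \ (s.ker.support : Set X')))) := hChain _ _ _ hCh''
  obtain ⟨ξ'', -, hS''⟩ := Chain.fibre hch'' hξ
  have hS''irr : IsIrreducible (closure (closure (τ ⁻¹' (S' \ (s.ker.support : Set X'))))) := by
    rw [hS'', closure_closure]; exact isIrreducible_singleton.closure
  haveI hint'' : IsIntegral (vanishingIdeal (⟨closure (closure (τ ⁻¹' (S' \ (s.ker.support : Set X')))), isClosed_closure⟩ :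
      Closeds X'')).subscheme := ComponentGluing.isIntegral_subscheme_vanishingIdeal _ hS''irr
  haveI hintD : IsIntegral (vanishingIdeal (⟨closure (closure (υ ⁻¹' (T₁ \
      {((vanishingIdeal (⟨closure T₁, isClosed_closure⟩ : Closeds F₁)).subschemeι x : F₁)}))), isClosed_closure⟩ :
      Closeds F₂)).subscheme := IsIntegral.of_isIso e₂.inv
  have hTirr₂ : IsIrreducible (closure (υ ⁻¹' (T₁ \ {((vanishingIdeal (⟨closure T₁, isClosed_closure⟩ :
      Closeds F₁)).subschemeι x : F₁)}))) := by
    have hr : Set.range (vanishingIdeal (⟨closure (closure (υ ⁻¹' (T₁ \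
        {((vanishingIdeal (⟨closure T₁, isClosed_closure⟩ : Closeds F₁)).subschemeι x : F₁)}))), isClosed_closure⟩ :
        Closeds F₂)).subschemeι = closure (υ ⁻¹' (T₁ \ {((vanishingIdeal (⟨closure T₁, isClosed_closure⟩ :
        Closeds F₁)).subschemeι x : F₁)})) := by
      rw [range_subschemeι, coe_support_vanishingIdeal]
      change closure (closure _) = closure _
      rw [closure_closure]
    rw [← hr, ← Set.image_univ]
    exact (IrreducibleSpace.isIrreducible_univ _).image _ (Scheme.Hom.continuous _).continuousOn
  exact ⟨X'', τ ≫ σ', closure (τ ⁻¹' (S' \ (s.ker.support : Set X'))), hCh'', hirr'', hgood'', hnoethF₂, hTirr₂, ⟨e₂⟩⟩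

end Summit.ResolutionOfSingularities.ResolutionOfSingularities.Cruxes.EquisingularLiftNat.Sections

end
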